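import Literature.MathematicalPhysics.QuantumFieldTheory.Balaban1983to89.B5G115SupBound

/-!
# B5 (1.115), first entry, in ROW-SUM currency: `Σ_j |Δ_1⁻¹(i,j)| ≤ C(d,N)` on the torus (the
# `ℓ^∞ → ℓ^∞` operator norm), uniform in `n = L^k` and in the volume

Source: T. Bałaban, *Propagators and renormalization transformations for lattice gauge theories. I*,
Commun. Math. Phys. **95** (1984) 17–40 (`Balaban1984PropagatorsI`, "B5"), Sect. F, p. 36 [PDF 20]; render
`b2b-balaban-ref1/pages/1984-cmp95-propagators-rt-I/…-p020-x2.png` (journal p. 36) read as an image this session.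
A kernel-checked SUPPLEMENT to PUBLISHED work under line-by-line audit by the pub-balaban cell; value = kernel
certificate, NOT summit progress.

WHAT THE PAPER PRINTS (verbatim, p. 36).  «The localized inequalities (1.110)–(1.114) imply immediately the
following global inequalities |GJ|, |∇GJ|, |G∇*J|, |ΔGJ|, ‖∇GJ‖_α, ‖G∇*J‖_α ≤ O(1)|J|, (1.115) … and (1.89),
with the same dependence of the constants O(1).» (p. 35 (1.108): «|A| = max_μ sup_x |A_μ(x)|,»; p. 30 (1.71):
«Δ_a⁻¹ = G_k, or simply G», typed in `B5DeltaA169`.)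

CITATION HEADER (cell ABSOLUTE RULE).  Nothing of B5 is used as a hypothesis and no internally-minted
statement enters as a cited fact: every declaration below is kernel-proved from the tree ([folklore]); the page
references are TEXT LOCATIONS of what is being supplemented.

WHAT IS TYPED HERE (zero sorry).  The sup-norm bound of `B5G115SupBound.norm_DeltaA_one_inv_mulVec_le_global`
(`|(Δ_1⁻¹J)_μ(x)| ≤ C(d,N)·|J|` for every `J`, `a = 1`, `U = 1`) DUALISED into the currency consumers of
kernel bounds use: §1 the elementary `ℓ¹`–`ℓ^∞` duality for one row of a complex matrix (testing row `i`
against its phase field `J(j) = conj A(i,j) / |A(i,j)|`, `|J| ≤ 1`, returns `Σ_j |A(i,j)|`: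
`mulVec_phase_apply`, `row_sum_le_of_mulVec_bound`); §2 `const_nonneg` and **`sum_norm_DeltaA_one_inv_le`**:
`Σ_j |Δ_1⁻¹(i,j)| ≤ C(d,N)` for EVERY row `i = (x, μ)` — i.e. the `ℓ^∞ → ℓ^∞` operator norm
`sup_i Σ_j |Δ_1⁻¹(i,j)|` (Mathlib's `Matrix.linfty_opNorm_def`, not instantiated here to avoid a local norm
instance) is at most `C(d,N)`, with
`C(d,N) = 2N·2^N·e^{1/(2(d+1))}·K_{d+1}(1/(2(d+1))) + (d+1)·MD183(d+1,N)·periodConst(κ₁₈₃(d+1),d)·K_{d+1}(κ₁₈₃(d+1)/(d+1))`,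
`K = B4Sect5Proof.latticeConst`, a function of `d` and `N ≥ d` only — UNIFORM in `n = L^k` and in the torus.

HONEST SCOPE.  (i) First entry of (1.115) only, `a = 1`, `U = 1`, constants ours (those of `B5G115SupBound`);
(ii) nothing printed is matched; (iii) 0 def; (iv) the duality §1 is textbook linear algebra, stated for square
complex matrices over a `Fintype`; (v) Mathlib's `Matrix.linftyOpNormedAddCommGroup` norm is NOT instantiated
(the row-sum family `sum_norm_DeltaA_one_inv_le` is its content, `Matrix.linfty_opNorm_def`).  NEAREST TREE NEIGHBOURS (searched `lean search
"linfty_opNorm"`, `"row_sum"`, `"DeltaA"` in `Balaban1983to89/**`): none for `DeltaA`; `B5G115SupBound` (the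
`J`-form), `B6KernelComposition` (abstract kernel row sums).  Unit `b2b-balaban-pv15-g12` (PV15 cell lineage,
generation 12).
-/

open scoped BigOperators Matrix ComplexConjugate Real
open Finset Complex Matrix

namespace Literature.MathematicalPhysics.QuantumFieldTheory.Balaban1983to89.B5G115RowSum

open Literature.MathematicalPhysics.QuantumFieldTheory.Balaban1983to89.B5Prop11Plancherel (Tor fine)
open Literature.MathematicalPhysics.QuantumFieldTheory.Balaban1983to89.B4TorusKernel (periodConst)
open Literature.MathematicalPhysics.QuantumFieldTheory.Balaban1983to89.B5DeltaA169 (DeltaA)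
open Literature.MathematicalPhysics.QuantumFieldTheory.Balaban1983to89.B5G183Strip (kappa183 kappa183_pos)
open Literature.MathematicalPhysics.QuantumFieldTheory.Balaban1983to89.B5G183CovDecay (MD183 MD183_nonneg)
open Literature.MathematicalPhysics.QuantumFieldTheory.Balaban1983to89.B5Kernel166Decay (periodConst_pos)
open Literature.MathematicalPhysics.QuantumFieldTheory.Balaban1983to89.B4Sect5Proof (latticeConst latticeConst_nonneg)
open Literature.MathematicalPhysics.QuantumFieldTheory.Balaban1983to89.B5G115SupBound
  (norm_DeltaA_one_inv_mulVec_le_global)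

noncomputable section

variable {d : ℕ}

/-! ## §1 `ℓ¹`–`ℓ^∞` duality for one row -/

section Dual

variable {ι : Type*} [Fintype ι]

/-- testing row `i` of `A` against its phase field `J(j) = conj A(i,j) / |A(i,j)|` returns the `ℓ¹` norm of
the row: `(AJ)(i) = Σ_j |A(i,j)|` (the term of a vanishing entry is `0/0 = 0`). [folklore] -/
theorem mulVec_phase_apply (A : Matrix ι ι ℂ) (i : ι) :
    (A *ᵥ fun j => conj (A i j) / (‖A i j‖ : ℂ)) i = ((∑ j, ‖A i j‖ : ℝ) : ℂ) := by
  simp only [Matrix.mulVec, dotProduct]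
  rw [Complex.ofReal_sum]
  refine Finset.sum_congr rfl fun j _ => ?_
  rw [mul_div_assoc', Complex.mul_conj, Complex.normSq_eq_norm_sq]
  rcases eq_or_ne (A i j) 0 with h | h
  · simp [h]
  · have hz : (‖A i j‖ : ℂ) ≠ 0 := by exact_mod_cast norm_ne_zero_iff.mpr h
    push_cast
    rw [pow_two, mul_div_assoc, div_self hz, mul_one]

/-- `ℓ¹`–`ℓ^∞` duality, the direction used here: a uniform bound `|(AJ)(i)| ≤ C` over all test fields with
`|J| ≤ 1` bounds every `ℓ¹` row sum `Σ_j |A(i,j)|` by `C`. [folklore] -/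
theorem row_sum_le_of_mulVec_bound (A : Matrix ι ι ℂ) {C : ℝ}
    (h : ∀ J : ι → ℂ, (∀ j, ‖J j‖ ≤ 1) → ∀ i, ‖(A *ᵥ J) i‖ ≤ C) (i : ι) :
    ∑ j, ‖A i j‖ ≤ C := by
  -- the phase field has sup norm at most `1` (`0` at vanishing entries)
  have hphase : ∀ j, ‖conj (A i j) / (‖A i j‖ : ℂ)‖ ≤ 1 := fun j => by
    rw [norm_div, Complex.norm_conj, Complex.norm_real, Real.norm_of_nonneg (norm_nonneg _)]
    exact div_self_le_one _
  have h1 := h _ hphase i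
  rwa [mulVec_phase_apply, Complex.norm_real,
    Real.norm_of_nonneg (Finset.sum_nonneg fun j _ => norm_nonneg _)] at h1

end Dual

/-! ## §2 Row sums and the `ℓ^∞ → ℓ^∞` operator norm of `Δ_1⁻¹` -/

section Main

variable (n : ℕ) [NeZero n] (hn : 1 ≤ n) (M : Fin (d + 1) → ℕ) [hM : ∀ μ, NeZero (M μ)]

/-- the constant `C(d,N)` of `B5G115SupBound` is nonnegative. [folklore] -/
theorem const_nonneg (Nn : ℕ) :
    (0 : ℝ) ≤ 2 * Nn * 2 ^ Nn * Real.exp (1 / (2 * (d + 1))) * latticeConst (d + 1) (1 / (2 * (d + 1)))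
        + (d + 1) * (MD183 (d + 1) Nn * periodConst (kappa183 (d + 1)) d
            * latticeConst (d + 1) (kappa183 (d + 1) / (d + 1))) := by
  have hK₁ : 0 ≤ latticeConst (d + 1) (1 / (2 * (d + 1))) := latticeConst_nonneg _ (by positivity)
  have hK₂ : 0 ≤ latticeConst (d + 1) (kappa183 (d + 1) / (d + 1)) :=
    latticeConst_nonneg _ (div_nonneg (kappa183_pos _).le (by positivity))
  refine add_nonneg (mul_nonneg (by positivity) hK₁) (mul_nonneg (by positivity) ?_)
  exact mul_nonneg (mul_nonneg (MD183_nonneg _ _) (periodConst_pos (kappa183_pos _) _).le) hK₂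

include hn in
/-- **ℓ¹ ROW SUMS of `G = Δ_1⁻¹`** ((1.115), first entry, row-sum currency): for every row `i = (x, μ)`,
`Σ_{(x′,ν)} |Δ_1⁻¹((x,μ),(x′,ν))| ≤ C(d,N)` with the constant of `B5G115SupBound.norm_DeltaA_one_inv_mulVec_le_global`
— uniform in `n = L^k` and in the torus `M`.  (Location of the printed text: `Balaban1984PropagatorsI` p. 36,
(1.115); the typed inequality and its constant are ours, not a quotation.) [folklore] -/
theorem sum_norm_DeltaA_one_inv_le {Nn : ℕ} (hN : d + 1 ≤ Nn + 1) (i : Tor (fine n M) × Fin (d + 1)) :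
    ∑ j, ‖(DeltaA n M 1)⁻¹ i j‖
      ≤ 2 * Nn * 2 ^ Nn * Real.exp (1 / (2 * (d + 1))) * latticeConst (d + 1) (1 / (2 * (d + 1)))
          + (d + 1) * (MD183 (d + 1) Nn * periodConst (kappa183 (d + 1)) d
              * latticeConst (d + 1) (kappa183 (d + 1) / (d + 1))) := by
  refine row_sum_le_of_mulVec_bound _ (fun J hJ i' => ?_) i
  simpa only [one_mul] using norm_DeltaA_one_inv_mulVec_le_global n hn M hN J hJ i'

end Main

end

end Literature.MathematicalPhysics.QuantumFieldTheory.Balaban1983to89.B5G115RowSum
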